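import Summits.QuantumFields.YangMills.Theorems.ColdStartUniversalityLatticeLangevinLawUniqueStart
import Summits.QuantumFields.YangMills.Theorems.ColdStartUniversalityLatticeLangevinFiltrationUniqueness
import Summits.QuantumFields.YangMills.Theorems.ColdStartUniversalityLatticeLangevinSolutionFiltrationChange
import Literature.Probability.Process.MartingaleNullEnlargement
import HarnessLib

/-!
# Route `ColdStartUniversality` (coupling infrastructure): UNIQUENESS IN LAW FOR WEAK SOLUTIONS of the SU(2) SZZ
# dynamics driven by a Brownian motion given in martingale form (e.g. a rotated noise `∫ R dB`)

Helper file (seat `ym-line-csu-p1`, g13; `--supports stmt-QuantumFields-27872`).  This is gap (G3) of the blocked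
definition item `defn-UnitScaleMixedCoupling` («(L1) needs Lévy characterisation + lawUnique_of_start applied to a process
on the COUPLED filtration, i.e. a weak-solution transfer — a theorem, not API», literature-prover 2026-08-28):

* ★ `map_eq_of_solution_martingaleDriver` — let `𝓕` be a filtration on a probability space `(Ω, P)`, `W'` an
  `𝓕`-adapted process whose coordinates are `𝓕`-martingales with `W'ᵃ W'ᵇ - δ_{ab} t` martingales and which is
  indistinguishable from SOME flat Brownian motion `W̃` (`IsFlatBrownian W̃ P`; exactly the output of
  `exists_isFlatBrownian_stochasticRotation` for a rotated noise `W' = ∫ R dB` on `𝓕 = σ(B)`), and let `V` be ANY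
  `𝓕`-adapted solution of the SU(2) SZZ system driven by `W'` from a deterministic start `v`.  Then `law(V_t)` is the
  law of THE strong solution from `v` (any flat driver, any space: `lawUnique_of_start`).

Proof («usual conditions» done by hand): zero `W'` on a measurable null set `N` containing the exceptional paths
(`W̃'`; again a flat Brownian motion, `isBrownianVec_congr_ae`), enlarge `𝓕` by `N` (`exists_filtration_sup_null`;
martingales survive, `Martingale.of_le_of_ae_measurableSet`), read `V` as a solution driven by `W̃'` on the enlarged
filtration (`isSolution_of_filtration_le`), transport the canonical strong solution along `ω ↦ W̃'(ω)` (`isSolution_comp`)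
and read it there too, and conclude by pathwise uniqueness on the enlarged filtration
(`latticeLangevin_pathwise_unique_filtration`).  THEOREMS ONLY, no sorry, standard axioms.  HONEST FRAMING: plumbing for
the coupling lines; the coupled-SDE well-posedness (G2) and every contraction / overlap estimate remain open; no crux,
rung R3 or summit is proved; the Yang–Mills mass gap is NOT proved.
-/

set_option autoImplicit false

noncomputable section

namespace Summit.QuantumFields.YangMills.Theorems.ColdStartUniversality

open MeasureTheory ProbabilityTheory Filter Topology
open scoped NNReal ENNReal BigOperators
open Literature.Probability.Process Literature.Analysis.FunctionSpaces
open Literature.MathematicalPhysics.QuantumFieldTheory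
open Literature.MathematicalPhysics.QuantumLattice (fundamentalRep fundamentalLatticeRep continuous_fundamentalRep)

/-- **A Brownian vector is unchanged by an everywhere-continuous modification**: if `B'` has measurable marginals,
continuous paths and `B' 0 = 0` for every `ω`, and `B' = B` at all times a.s. for a Brownian vector `B`, then `B'` is a
Brownian vector. [folklore] -/
theorem isBrownianVec_congr_ae {Ω : Type*} {mΩ : MeasurableSpace Ω} {P : Measure Ω} {n : ℕ}
    {B B' : ℝ≥0 → Ω → (Fin n → ℝ)} (hB : IsBrownianVec B P) (hm : ∀ t, Measurable (B' t))
    (hc : ∀ ω, Continuous fun t => B' t ω) (h0 : ∀ ω, B' 0 ω = 0) (hae : ∀ᵐ ω ∂P, ∀ t, B' t ω = B t ω) :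
    IsBrownianVec B' P where
  measurable := hm
  continuous_path := hc
  apply_zero := h0
  indep_shift s := by
    refine (hB.indep_shift s).congr ?_ ?_
    · filter_upwards [hae] with ω hω
      funext u
      simp only [vecShift, hω]
    · filter_upwards [hae] with ω hω
      funext r
      simp only [vecPast, hω]
  map_shift s := by
    have e1 : P.map (vecShift B' s) = P.map (vecShift B s) :=
      Measure.map_congr (by filter_upwards [hae] with ω hω; funext u; simp only [vecShift, hω])
    have e2 : P.map (vecPath B') = P.map (vecPath B) :=
      Measure.map_congr (by filter_upwards [hae] with ω hω; funext u; simp only [vecPath, hω])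
    rw [e1, e2, hB.map_shift s]
  map_apply t := by
    rw [← hB.map_apply t]
    exact Measure.map_congr (by filter_upwards [hae] with ω hω; exact hω t)

variable {Ω : Type} {mΩ : MeasurableSpace Ω} {P : Measure Ω} {𝓕 : Filtration ℝ≥0 mΩ} {L : ℕ} [NeZero L]
  {W' Wt : ℝ≥0 → Ω → (Edge 3 L × NoiseIdx 2 → ℝ)}

/-- ★ **Uniqueness in law for solutions driven by a Brownian motion in martingale form** (weak-solution transfer).
Let `W'` be `𝓕`-adapted with coordinates `𝓕`-martingales and `W'ᵃW'ᵇ - δ_{ab} t` martingales, indistinguishable from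
a flat Brownian motion `Wt`; let `V` be an `𝓕`-adapted solution of the SU(2) SZZ system at coupling `β'` driven by `W'`
with `V 0 = v`.  Then for every `t`, `law(V_t)` equals `law(U_t)` for any strong solution `U` from `v` driven by any
flat Brownian motion on any probability space. [cite: RevuzYor1999, Ch. IX Thm (1.7)] -/
theorem map_eq_of_solution_martingaleDriver [IsProbabilityMeasure P] (β' : ℝ)
    (v : GaugeConfig 3 L (Matrix.specialUnitaryGroup (Fin 2) ℂ))
    (hW'm : ∀ a, Martingale (fun t ω => W' t ω a) 𝓕 P)
    (hW'B : ∀ a b, Martingale (fun t ω => W' t ω a * W' t ω b - if a = b then (t : ℝ) else 0) 𝓕 P)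
    (hWt : IsFlatBrownian Wt P) (hae : ∀ᵐ ω ∂P, ∀ t, Wt t ω = W' t ω)
    {V : ℝ≥0 → Ω → GaugeConfig 3 L (Matrix.specialUnitaryGroup (Fin 2) ℂ)} (hV0 : ∀ ω, V 0 ω = v)
    (hV : (latticeLangevinDynamics (fundamentalLatticeRep 2) β').IsSolution (fundamentalRep (Fin 2)) 𝓕 P W' V)
    {Ω₂ : Type} {mΩ₂ : MeasurableSpace Ω₂} {P₂ : Measure Ω₂} [IsProbabilityMeasure P₂]
    {W₂ : ℝ≥0 → Ω₂ → (Edge 3 L × NoiseIdx 2 → ℝ)} (hW₂ : IsFlatBrownian W₂ P₂)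
    {U₂ : ℝ≥0 → Ω₂ → GaugeConfig 3 L (Matrix.specialUnitaryGroup (Fin 2) ℂ)} (hU₂0 : ∀ ω, U₂ 0 ω = v)
    (hU₂ : (latticeLangevinDynamics (fundamentalLatticeRep 2) β').IsSolution (fundamentalRep (Fin 2))
      hW₂.natFiltration P₂ W₂ U₂) (t : ℝ≥0) :
    P.map (V t) = P₂.map (U₂ t) := by
  classical
  -- Step 1: the exceptional null set and the modification `W̃' = 𝟙_{Nᶜ} W'`
  obtain ⟨N, hNsub, hNm, hN0⟩ := exists_measurable_superset_of_null (ae_iff.1 hae)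
  have hoff : ∀ ω, ω ∉ N → ∀ t, Wt t ω = W' t ω := fun ω hω => by
    by_contra h
    exact hω (hNsub h)
  set Wn : ℝ≥0 → Ω → (Edge 3 L × NoiseIdx 2 → ℝ) := fun t ω => if ω ∈ N then 0 else W' t ω with hWn
  have hWn_off : ∀ ω, ω ∉ N → ∀ t, Wn t ω = Wt t ω := fun ω hω t => by
    simp only [hWn, hω, if_false, hoff ω hω t]
  have hWn_on : ∀ ω, ω ∈ N → ∀ t, Wn t ω = 0 := fun ω hω t => by simp only [hWn, hω, if_true]
  have hW'meas𝓕 : ∀ t, Measurable[𝓕 t] (W' t) := fun t =>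
    @measurable_pi_lambda _ _ _ (𝓕 t) _ _ fun a => ((hW'm a).stronglyMeasurable t).measurable
  have hW'meas : ∀ t, Measurable (W' t) := fun t => (hW'meas𝓕 t).mono (𝓕.le t) le_rfl
  have hWnmeas : ∀ t, Measurable (Wn t) := fun t => Measurable.ite hNm measurable_const (hW'meas t)
  have hWnae : ∀ᵐ ω ∂P, ∀ t, Wn t ω = W' t ω := by
    filter_upwards [compl_mem_ae_iff.2 hN0] with ω hω t
    rw [hWn_off ω hω t, hoff ω hω t]
  have hWnaeWt : ∀ᵐ ω ∂P, ∀ t, Wn t ω = Wt t ω := by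
    filter_upwards [compl_mem_ae_iff.2 hN0] with ω hω t
    exact hWn_off ω hω t
  have hWnc : ∀ ω, Continuous fun t => Wn t ω := by
    intro ω
    by_cases hω : ω ∈ N
    · have : (fun t => Wn t ω) = fun _ => 0 := funext fun t => hWn_on ω hω t
      rw [this]; exact continuous_const
    · have : (fun t => Wn t ω) = fun t => Wt t ω := funext fun t => hWn_off ω hω t
      rw [this]; exact (continuous_path_and_zero hWt ω).1
  have hWn0 : ∀ ω, Wn 0 ω = 0 := by
    intro ω
    by_cases hω : ω ∈ N
    · exact hWn_on ω hω 0
    · rw [hWn_off ω hω 0]; exact (continuous_path_and_zero hWt ω).2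
  -- `Wn` is a flat Brownian motion (continuous modification of `Wt`)
  have hWnflat : IsFlatBrownian Wn P := by
    refine isBrownianVec_congr_ae hWt (fun t => measurable_pi_lambda _ fun k => (measurable_pi_apply _).comp (hWnmeas t))
      (fun ω => continuous_pi fun k => (continuous_apply _).comp (hWnc ω)) (fun ω => ?_) ?_
    · funext k; simp [hWn0 ω]
    · filter_upwards [hWnaeWt] with ω hω t
      funext k; simp [hω t]
  -- Step 2: the enlarged filtration `𝓖 = 𝓕 ⊔ σ(N)`
  obtain ⟨𝓖, hFG, hGN, hGae⟩ := exists_filtration_sup_null 𝓕 P hNm hN0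
  have hWnadapt : ∀ t, Measurable[𝓖 t] (Wn t) := fun t =>
    Measurable.ite (hGN t) (@measurable_const _ _ _ (𝓖 t) _) ((hW'meas𝓕 t).mono (hFG t) le_rfl)
  have hWnadapt' : ∀ t a, StronglyMeasurable[𝓖 t] (fun ω => Wn t ω a) := fun t a =>
    ((@measurable_pi_apply _ _ _ a).comp (hWnadapt t) |>.stronglyMeasurable)
  -- Step 3: the coordinates of `Wn` are `𝓖`-Brownian motions in martingale form
  have hWn_m : ∀ a, Martingale (fun t ω => Wn t ω a) 𝓖 P := fun a =>
    (Literature.Probability.Process.Martingale.of_le_of_ae_measurableSet (hW'm a) hFG hGae).congr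
      (fun t => hWnadapt' t a)
      fun t => hWnae.mono fun ω hω => by simp only [hω t]
  have hWn_sq : ∀ a, Martingale (fun t ω => Wn t ω a ^ 2 - (t : ℝ)) 𝓖 P := by
    intro a
    have h := hW'B a a
    simp only [if_true] at h
    refine (Literature.Probability.Process.Martingale.of_le_of_ae_measurableSet h hFG hGae).congr
      (fun t => ?_) fun t => ?_
    · exact ((hWnadapt' t a).pow 2).sub stronglyMeasurable_const
    · exact hWnae.mono fun ω hω => by simp only [hω t]; ring
  have hWn_2 : ∀ t a, MemLp (fun ω => Wn t ω a) 2 P := by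
    intro t a
    have hint : Integrable (fun ω => W' t ω a * W' t ω a - (t : ℝ)) P := by
      have h := (hW'B a a).integrable t
      simp only [if_true] at h
      exact h
    have hsq : Integrable (fun ω => W' t ω a ^ 2) P := by
      have h2 := hint.add (integrable_const (t : ℝ))
      refine h2.congr (ae_of_all _ fun ω => ?_)
      simp only [Pi.add_apply]; ring
    have hm : AEStronglyMeasurable (fun ω => W' t ω a) P :=
      ((measurable_pi_apply a).comp (hW'meas t)).aestronglyMeasurable
    exact ((memLp_two_iff_integrable_sq hm).2 hsq).ae_eq (hWnae.mono fun ω hω => by simp only [hω t])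
  have hWn_c : ∀ a ω, Continuous fun t => Wn t ω a := fun a ω => (continuous_apply a).comp (hWnc ω)
  -- Step 4: `V` is a `𝓖`-solution driven by `Wn`
  have hV𝓖 : (latticeLangevinDynamics (fundamentalLatticeRep 2) β').IsSolution (fundamentalRep (Fin 2)) 𝓖 P Wn V :=
    isSolution_of_filtration_le β' hFG hWn_m hWn_sq hWn_2 hWn_c hWnae hV
  -- Step 5: the canonical strong solution transported along `ω ↦ Wn(ω)`, read on `𝓖`
  have hφ := measurable_pathMap hWnflat
  have hWc := isFlatBrownian_canonical hWnflat
  haveI : IsProbabilityMeasure (P.map (fun ω => (⟨fun t => Wn t ω, continuous_path_and_zero hWnflat ω⟩ :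
      {p : ℝ≥0 → (Edge 3 L × NoiseIdx 2 → ℝ) // Continuous p ∧ p 0 = 0}))) :=
    Measure.isProbabilityMeasure_map hφ.aemeasurable
  obtain ⟨Uc, hUc0, hUc⟩ := solution_from_start hWc β' v
  have hsol : (latticeLangevinDynamics (fundamentalLatticeRep 2) β').IsSolution (fundamentalRep (Fin 2))
      hWnflat.natFiltration P Wn (fun s ω => Uc s ⟨fun t => Wn t ω, continuous_path_and_zero hWnflat ω⟩) :=
    isSolution_comp hWnflat hWc hφ rfl (fun _ _ => rfl) β' hUc
  have hnat_le : ∀ t, hWnflat.natFiltration t ≤ 𝓖 t := by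
    intro t
    change (⨆ j ≤ t, MeasurableSpace.comap (Wn j) inferInstance) ≤ 𝓖 t
    exact iSup₂_le fun j hj => (hWnadapt j).comap_le.trans (𝓖.mono hj)
  have hsol𝓖 : (latticeLangevinDynamics (fundamentalLatticeRep 2) β').IsSolution (fundamentalRep (Fin 2)) 𝓖 P Wn
      (fun s ω => Uc s ⟨fun t => Wn t ω, continuous_path_and_zero hWnflat ω⟩) :=
    isSolution_of_filtration_le β' hnat_le hWn_m hWn_sq hWn_2 hWn_c (ae_of_all _ fun ω t => rfl) hsol
  -- Step 6: pathwise uniqueness on `𝓖`, then the law of the strong solution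
  have huniq := latticeLangevin_pathwise_unique_filtration hWn_m hWn_sq hWn_2 hWn_c β' v hV0 (fun ω => hUc0 _)
    hV𝓖 hsol𝓖
  calc P.map (V t) = P.map (fun ω => Uc t ⟨fun t => Wn t ω, continuous_path_and_zero hWnflat ω⟩) :=
        Measure.map_congr (huniq.mono fun ω hω => hω t)
    _ = P₂.map (U₂ t) := lawUnique_of_start β' v hWnflat hW₂ (fun ω => hUc0 _) hsol hU₂0 hU₂ t

end Summit.QuantumFields.YangMills.Theorems.ColdStartUniversality

end
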